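import Summits.QuantumFields.YangMills.Theorems.BalabanUVNodesN15PerCubeGreenAdjointRows
import HarnessLib

/-!
# N15 = NE2 — PROGRAMME (PC-E), service row for (C3)∕(C5): THE OUTPUT SUPPORT OF A COMMUTATOR PIECE `[Δ, M_{h_k}]∘G` — generic («finite range of `Δ`»), through any
# gauge sandwich `M_W∘Δ∘M_{W′}`, and on the (PC) SITE carrier for Bałaban's CURVED operator `Δ_U = covLapM + c·Q′(U)ᵀQ′(U)` (every `U`) and its flat edition

Cell `pub-ymgap`, seat `pub-ymgap-dag-n15-a` (generation g37; KNIT-BY-NAME, count-neutral; HUMAN RULING D-0062; chair R424 venue).  `bears_on: R4∕N15 · K3⁸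
SpineGivenEndpointR13SepCoPHV (stmt-QuantumFields-27366)`; filed `--supports stmt-QuantumFields-27366 --as helper` — COUNT-NEUTRAL.  THEOREMS only ([folklore] support
bookkeeping), 0 `def`, 0 `sorry`.  Imports BY NAME n15-c∕26x `…PerCubeGreenAdjointRows` (`scPsi_near_scChi`, `mulOp_one_sub_scPsi_comp_lapOp_comp_mulOp_scH`,
`mulOp_one_sub_scPsi_comp_scQQ_comp_mulOp_scH`, the (PC) site objects `ScX`∕`scPsi`∕`scChi`∕`scH`∕`scShift`∕`scQQ`), and through it dag-n15-w3 `mulOp_comp_covLapM_comp_mulOp_eq_zero`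
(`…CurvedGluingCubeSandwichDefect`), n15-c `mmulOp`∕`mmulOp_comp_mulOp_fst`, n15-c∕181 `csavg`∕`csavg_transpose_mul_csavg_apply`, n15-b `covLapM`, dag-n15-a `commOp`,
pub-balaban `mulOp`.  Nothing in the tree is modified, no landed name re-declared.

WHY (dag-n15-c g31 ASK I.21041 2026-08-30T23:18:39Z, reduced I.21061 23:23:29Z: «the commutator output-support identity on SITES at (C5) time (finite range of `Δ`)»).
n15-c∕333 `hasMaj_idef_glued_of_localGauges_tr` ∕ `commDefect_of_localGauge_tr` carry, for every cube `k`, the hypothesis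
`hKout : M_{ψout k ∘ pr₁}∘([M_{W′σ}∘Δ∘M_{(W′σ)ᵀ}, M_{h_k ∘ pr₁}]∘G′_k) = [M_{W′σ}∘Δ∘M_{(W′σ)ᵀ}, M_{h_k ∘ pr₁}]∘G′_k` — the commutator piece writes only under the plateau `ψout k`.
It holds because `Δ` has FINITE RANGE: `([Δ, M_h]f)(x) = Σ_z Δ(x,z)(h(z) − h(x))f(z)` vanishes unless the `Δ`-neighbourhood of `x` meets `supp h`, and the plateau `ψ_k` is `1` one
step (and one unit block) around `supp h_k ⊆ {χ_k ≠ 0}` (n15-c∕26x `scPsi_near_scChi`; `χ_k` is block-constant).  THIS FILE proves it once for all `Δ` in the algebraic form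
`(h ≠ 0 ⟹ ψ = 1) ∧ M_{1−ψ}∘Δ∘M_h = 0 ⟹ M_ψ∘[Δ, M_h] = [Δ, M_h]`, shows the locality row `M_{1−ψ}∘Δ∘M_h = 0` is additive in `Δ`, passes through gauge sandwiches, and follows
from a finite-range criterion; then discharges it on the (PC) site carrier for the two summands of Bałaban's curved operator — the covariant Laplacian `covLapM` (one-step local,
dag-n15-w3) and the covariant block Gram `c·Q′_TᵀQ′_T` (block-diagonal for EVERY stair datum `T`, hence every `U`) — giving `hKout` for `Δ_U` and for its flat edition.

RESULTS ([folklore]; `M_a = mulOp a`, `[Δ, M_h] = commOp Δ h`, `M_W = mmulOp W`)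
* §1 (any carrier `Y`) `mulOp_comp_commOp_of_support` (OUTPUT support), `commOp_comp_mulOp_of_support` (INPUT support, locality in 52's [hT] shape `M_h∘Δ∘M_{1−ψ} = 0`),
  `mulOp_comp_commOp_comp_of_support` (with a right factor `G`); `mulOp_comp_add_comp_mulOp_eq_zero` ∕ `mulOp_comp_smul_comp_mulOp_eq_zero` ∕ `mulOp_comp_neg_comp_mulOp_eq_zero` ∕
  `mulOp_comp_sub_comp_mulOp_eq_zero` (locality rows are linear in `Δ`);
  ★ `mulOp_comp_comp_mulOp_eq_zero_of_range` (finite range `R` + `a(y)b(z) = 0` on `R` ⟹ `M_a∘Δ∘M_b = 0`).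
* §2 (product carriers `X × ι`) `mulOp_fst_comp_conj_comp_mulOp_fst` ∕ `mulOp_fst_comp_conj_comp_mulOp_fst_eq_zero` (gauge sandwiches), ★ `csavgGram_apply_eq_zero_of_blockOf_ne` ∕
  `mulOp_comp_csavgGram_comp_mulOp_eq_zero` (the covariant Gram is block-diagonal, any `T`), ★★ `mulOp_comp_commOp_conj_comp_of_support` (= 333's `hKout` shape from the locality
  row of `Δ` alone, any `W, W′, G`), `mulOp_comp_commOp_comp_of_support_fst` (no sandwich).
* §3 ((PC) site carrier `ScX d L mv kk hL × ι`, `ψ = scPsi k`, `h = scH k`) `one_sub_scPsi_mul_scH_stencil`; the locality rows `M_{1−ψ_k}∘Δ∘M_{h_k} = 0` of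
  `mulOp_one_sub_scPsi_comp_covLapM_comp_mulOp_scH` (covariant Laplacian, any bond transports `R`), `mulOp_one_sub_scPsi_comp_speciesOpM_comp_mulOp_scH` (any background species ∕ jet
  `V̂ = speciesOpM scShift n C A`), `mulOp_one_sub_scPsi_comp_lapOp_comp_mulOp_scH_of_row` (dressed Laplacian `Σ∇*∇ + W_p`, any `W_p` with its own row),
  `mulOp_one_sub_scPsi_comp_csavgGram_comp_mulOp_scH` (covariant Gram, any `T`) — so the row of n15-c's (C5) operator `Σ∇*∇ + W + N_L − V̂_k + F_k` is assembled by §1's additivity; ★★ `mulOp_scPsi_comp_commOp_conj_comp` (the CURVED row: `Δ_U = covLapM scShift η R + mulVecLin (c•Q′_TᵀQ′_T)`,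
  every `R, T, W, W′, G`), `mulOp_scPsi_comp_commOp_conj_comp_flat` (`Δ = lapOp cc (liftEquiv scShift) 0 + scQQ a ι`, n15-c∕26x rows).

HONEST FRAMING ∕ LIMITS.  Support bookkeeping only — no estimate, no rate; MODEL carriers; nothing of [B9] asserted; NE2⁺ NOT PRINTED, NOT proved; N15 of record untouched
(DISCHARGED AS CONSUMED, p687738); K3⁸ OPEN; counts of record UNMOVED (typed 28∕28 · discharged 8∕27); one finite 𝕋⁴ at fixed ε per index — NOT infinite volume, NOT OS on
ℝ⁴, NOT a mass gap, NOT Clay.  Restate-immune (no Theses import).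
-/

noncomputable section

open scoped BigOperators Matrix
open Finset

namespace Summit.QuantumFields.YangMills.BalabanUVNodes.N15.Gluing

open Literature.MathematicalPhysics.QuantumFieldTheory.Balaban1983to89
open Literature.MathematicalPhysics.QuantumFieldTheory.Balaban1983to89.B5Prop11Plancherel (Tor fine)
open Literature.MathematicalPhysics.QuantumFieldTheory.Balaban1983to89.B6Prop26Gluing (mulOp mulOp_apply)
open Literature.MathematicalPhysics.QuantumFieldTheory.King1986.Torus (blockOf)
open Summit.QuantumFields.YangMills.BalabanUVNodes.N15.MatrixSpecies (mmulOp mmulOp_apply liftEquiv)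
open Summit.QuantumFields.YangMills.BalabanUVNodes.N15.BackgroundLayer (covLapM speciesOpM)
open Summit.QuantumFields.YangMills.BalabanUVNodes.N15.CurvedSpecies (mmulOp_comp_mulOp_fst mulOp_comp_covLapM_comp_mulOp_eq_zero mulOp_comp_speciesOpM_comp_mulOp_eq_zero
  mulOp_comp_lapOp_comp_mulOp)
open Summit.QuantumFields.YangMills.BalabanUVNodes.N15.CovLandau (csavg csavg_transpose_mul_csavg_apply)
open Summit.QuantumFields.YangMills.BalabanUVNodes.N15.TwoGrid (chiCube)

variable {d : ℕ}

/-! ## §1 Output ∕ input support of a commutator from a locality row; locality rows are linear in `Δ`; the finite-range criterion -/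

section Generic

variable {Y : Type}

/-- ★ **OUTPUT SUPPORT OF A COMMUTATOR**: if `ψ = 1` on `supp h` and `M_{1−ψ}∘Δ∘M_h = 0` (`Δ` does not couple `supp h` to `{ψ ≠ 1}`), then `M_ψ∘[Δ, M_h] = [Δ, M_h]`.
[cite: Balaban1984PropagatorsII, (2.92)–(2.93) p.239 (the commutator pieces: shape)] -/
theorem mulOp_comp_commOp_of_support {Δ : (Y → ℝ) →ₗ[ℝ] (Y → ℝ)} {h ψ : Y → ℝ} (hψh : ∀ y, h y ≠ 0 → ψ y = 1)
    (hloc : mulOp (fun y => 1 - ψ y) ∘ₗ Δ ∘ₗ mulOp h = 0) : mulOp ψ ∘ₗ commOp Δ h = commOp Δ h := by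
  refine LinearMap.ext fun f => funext fun y => ?_
  have hz := congrFun (LinearMap.congr_fun hloc f) y
  rw [LinearMap.comp_apply, LinearMap.comp_apply, mulOp_apply, LinearMap.zero_apply, Pi.zero_apply, sub_mul, one_mul, sub_eq_zero] at hz
  rw [LinearMap.comp_apply, mulOp_apply, commOp, LinearMap.sub_apply, LinearMap.comp_apply, LinearMap.comp_apply, Pi.sub_apply, mulOp_apply, mul_sub, ← hz]
  by_cases hy : h y = 0
  · rw [hy, zero_mul, mul_zero]
  · rw [hψh y hy, one_mul]

/-- ★ **INPUT SUPPORT OF A COMMUTATOR**: if `ψ = 1` on `supp h` and `M_h∘Δ∘M_{1−ψ} = 0` (dag-n15-a∕52's tail hypothesis [hT]), then `[Δ, M_h]∘M_ψ = [Δ, M_h]`.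
[cite: Balaban1984PropagatorsII, (2.92)–(2.93) p.239 (shape)] -/
theorem commOp_comp_mulOp_of_support {Δ : (Y → ℝ) →ₗ[ℝ] (Y → ℝ)} {h ψ : Y → ℝ} (hψh : ∀ y, h y ≠ 0 → ψ y = 1)
    (hloc : mulOp h ∘ₗ Δ ∘ₗ mulOp (fun y => 1 - ψ y) = 0) : commOp Δ h ∘ₗ mulOp ψ = commOp Δ h := by
  have hhψ : mulOp h ∘ₗ mulOp ψ = mulOp h := mulOp_comp_mulOp_of_support hψh
  refine LinearMap.ext fun f => funext fun y => ?_
  have hz := congrFun (LinearMap.congr_fun hloc f) y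
  have e1 : mulOp (fun y => 1 - ψ y) f = f - mulOp ψ f := funext fun z => by
    rw [mulOp_apply, Pi.sub_apply, mulOp_apply, sub_mul, one_mul]
  rw [LinearMap.comp_apply, LinearMap.comp_apply, mulOp_apply, LinearMap.zero_apply, Pi.zero_apply, e1, map_sub, Pi.sub_apply, mul_sub, sub_eq_zero] at hz
  have e2 : mulOp h (mulOp ψ f) = mulOp h f := by rw [← LinearMap.comp_apply, hhψ]
  rw [LinearMap.comp_apply, commOp, LinearMap.sub_apply, LinearMap.sub_apply, LinearMap.comp_apply, LinearMap.comp_apply, LinearMap.comp_apply, LinearMap.comp_apply,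
    Pi.sub_apply, Pi.sub_apply, mulOp_apply, mulOp_apply (h) (Δ f), e2, hz]

/-- the output-support identity with a right factor: `M_ψ∘([Δ, M_h]∘G) = [Δ, M_h]∘G`. [folklore] -/
theorem mulOp_comp_commOp_comp_of_support {F : Type} [AddCommGroup F] [Module ℝ F] {Δ : (Y → ℝ) →ₗ[ℝ] (Y → ℝ)} (G : F →ₗ[ℝ] (Y → ℝ)) {h ψ : Y → ℝ}
    (hψh : ∀ y, h y ≠ 0 → ψ y = 1) (hloc : mulOp (fun y => 1 - ψ y) ∘ₗ Δ ∘ₗ mulOp h = 0) : mulOp ψ ∘ₗ (commOp Δ h ∘ₗ G) = commOp Δ h ∘ₗ G := by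
  rw [← LinearMap.comp_assoc, mulOp_comp_commOp_of_support hψh hloc]

/-- locality rows add: `M_a∘Δ₁∘M_b = 0`, `M_a∘Δ₂∘M_b = 0` ⟹ `M_a∘(Δ₁ + Δ₂)∘M_b = 0`. [folklore] -/
theorem mulOp_comp_add_comp_mulOp_eq_zero {Δ₁ Δ₂ : (Y → ℝ) →ₗ[ℝ] (Y → ℝ)} {a b : Y → ℝ} (h₁ : mulOp a ∘ₗ Δ₁ ∘ₗ mulOp b = 0) (h₂ : mulOp a ∘ₗ Δ₂ ∘ₗ mulOp b = 0) :
    mulOp a ∘ₗ (Δ₁ + Δ₂) ∘ₗ mulOp b = 0 := by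
  rw [LinearMap.add_comp, LinearMap.comp_add, h₁, h₂, add_zero]

/-- locality rows scale: `M_a∘Δ∘M_b = 0` ⟹ `M_a∘(c•Δ)∘M_b = 0`. [folklore] -/
theorem mulOp_comp_smul_comp_mulOp_eq_zero {Δ : (Y → ℝ) →ₗ[ℝ] (Y → ℝ)} {a b : Y → ℝ} (c : ℝ) (h : mulOp a ∘ₗ Δ ∘ₗ mulOp b = 0) :
    mulOp a ∘ₗ (c • Δ) ∘ₗ mulOp b = 0 := by
  rw [LinearMap.smul_comp, LinearMap.comp_smul, h, smul_zero]

/-- locality rows negate: `M_a∘Δ∘M_b = 0` ⟹ `M_a∘(−Δ)∘M_b = 0`. [folklore] -/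
theorem mulOp_comp_neg_comp_mulOp_eq_zero {Δ : (Y → ℝ) →ₗ[ℝ] (Y → ℝ)} {a b : Y → ℝ} (h : mulOp a ∘ₗ Δ ∘ₗ mulOp b = 0) : mulOp a ∘ₗ (-Δ) ∘ₗ mulOp b = 0 := by
  rw [LinearMap.neg_comp, LinearMap.comp_neg, h, neg_zero]

/-- locality rows subtract: `M_a∘Δ₁∘M_b = 0`, `M_a∘Δ₂∘M_b = 0` ⟹ `M_a∘(Δ₁ − Δ₂)∘M_b = 0`. [folklore] -/
theorem mulOp_comp_sub_comp_mulOp_eq_zero {Δ₁ Δ₂ : (Y → ℝ) →ₗ[ℝ] (Y → ℝ)} {a b : Y → ℝ} (h₁ : mulOp a ∘ₗ Δ₁ ∘ₗ mulOp b = 0) (h₂ : mulOp a ∘ₗ Δ₂ ∘ₗ mulOp b = 0) :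
    mulOp a ∘ₗ (Δ₁ - Δ₂) ∘ₗ mulOp b = 0 := by
  rw [LinearMap.sub_comp, LinearMap.comp_sub, h₁, h₂, sub_zero]

/-- ★ **THE FINITE-RANGE CRITERION**: if `(Δf)(y)` only reads `f` on the `R`-neighbourhood of `y` and `a(y)·b(z) = 0` whenever `R y z`, then `M_a∘Δ∘M_b = 0`.
[cite: Balaban1984PropagatorsII, (2.38) p.229 (mechanism: finite-range operators between separated multipliers)] -/
theorem mulOp_comp_comp_mulOp_eq_zero_of_range {Δ : (Y → ℝ) →ₗ[ℝ] (Y → ℝ)} (R : Y → Y → Prop) (hΔ : ∀ f y, (∀ z, R y z → f z = 0) → Δ f y = 0) {a b : Y → ℝ}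
    (hab : ∀ y z, R y z → a y * b z = 0) : mulOp a ∘ₗ Δ ∘ₗ mulOp b = 0 := by
  refine LinearMap.ext fun f => funext fun y => ?_
  rw [LinearMap.comp_apply, LinearMap.comp_apply, mulOp_apply, LinearMap.zero_apply, Pi.zero_apply]
  by_cases ha : a y = 0
  · rw [ha, zero_mul]
  · rw [hΔ (mulOp b f) y fun z hz => ?_, mul_zero]
    rw [mulOp_apply, (mul_eq_zero.1 (hab y z hz)).resolve_left ha, zero_mul]

end Generic

/-! ## §2 Product carriers: gauge sandwiches, the block-diagonal covariant Gram, and 333's `hKout` shape -/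

section Product

variable {X ι : Type} [Fintype ι] [DecidableEq ι]

omit [DecidableEq ι] in
/-- scalar multipliers pass through matrix coefficients: `M_{a∘pr₁}∘(M_W∘Δ∘M_{W′})∘M_{b∘pr₁} = M_W∘(M_{a∘pr₁}∘Δ∘M_{b∘pr₁})∘M_{W′}` (n15-c `mmulOp_comp_mulOp_fst`). [folklore] -/
theorem mulOp_fst_comp_conj_comp_mulOp_fst (a b : X → ℝ) (W W' : X → Matrix ι ι ℝ) (Δ : (X × ι → ℝ) →ₗ[ℝ] (X × ι → ℝ)) :
    mulOp (fun p : X × ι => a p.1) ∘ₗ (mmulOp W ∘ₗ Δ ∘ₗ mmulOp W') ∘ₗ mulOp (fun p : X × ι => b p.1) =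
      mmulOp W ∘ₗ (mulOp (fun p : X × ι => a p.1) ∘ₗ Δ ∘ₗ mulOp (fun p : X × ι => b p.1)) ∘ₗ mmulOp W' := by
  simp only [LinearMap.comp_assoc]
  rw [mmulOp_comp_mulOp_fst W' b, ← LinearMap.comp_assoc _ (mmulOp W) (mulOp fun p : X × ι => a p.1), ← mmulOp_comp_mulOp_fst W a, LinearMap.comp_assoc]

omit [DecidableEq ι] in
/-- hence a locality row of `Δ` is a locality row of every gauge sandwich `M_W∘Δ∘M_{W′}`. [folklore] -/
theorem mulOp_fst_comp_conj_comp_mulOp_fst_eq_zero {a b : X → ℝ} (W W' : X → Matrix ι ι ℝ) {Δ : (X × ι → ℝ) →ₗ[ℝ] (X × ι → ℝ)}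
    (hloc : mulOp (fun p : X × ι => a p.1) ∘ₗ Δ ∘ₗ mulOp (fun p : X × ι => b p.1) = 0) :
    mulOp (fun p : X × ι => a p.1) ∘ₗ (mmulOp W ∘ₗ Δ ∘ₗ mmulOp W') ∘ₗ mulOp (fun p : X × ι => b p.1) = 0 := by
  rw [mulOp_fst_comp_conj_comp_mulOp_fst, hloc, LinearMap.zero_comp, LinearMap.comp_zero]

omit [DecidableEq ι] in
/-- ★★ **333's `hKout` FROM THE LOCALITY ROW OF `Δ` ALONE**: `(h ≠ 0 ⟹ ψ = 1) ∧ M_{1−ψ}∘Δ∘M_h = 0 ⟹ M_{ψ∘pr₁}∘([M_W∘Δ∘M_{W′}, M_{h∘pr₁}]∘G) = [M_W∘Δ∘M_{W′}, M_{h∘pr₁}]∘G`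
for all matrix coefficients `W, W′` and every right factor `G` (n15-c∕333 `commDefect_of_localGauge_tr` ∕ `hasMaj_idef_glued_of_localGauges_tr`, hypothesis `hKout`).
[cite: Balaban1984PropagatorsII, (2.92)–(2.93) p.239 (shape); Balaban1985BackgroundPropagators, (3.88)–(3.89) p.409 (shape)] -/
theorem mulOp_comp_commOp_conj_comp_of_support {F : Type} [AddCommGroup F] [Module ℝ F] {Δ : (X × ι → ℝ) →ₗ[ℝ] (X × ι → ℝ)} (W W' : X → Matrix ι ι ℝ)
    (G : F →ₗ[ℝ] (X × ι → ℝ)) {h ψ : X → ℝ} (hψh : ∀ x, h x ≠ 0 → ψ x = 1)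
    (hloc : mulOp (fun p : X × ι => 1 - ψ p.1) ∘ₗ Δ ∘ₗ mulOp (fun p : X × ι => h p.1) = 0) :
    mulOp (fun p : X × ι => ψ p.1) ∘ₗ (commOp (mmulOp W ∘ₗ Δ ∘ₗ mmulOp W') (fun p : X × ι => h p.1) ∘ₗ G) =
      commOp (mmulOp W ∘ₗ Δ ∘ₗ mmulOp W') (fun p : X × ι => h p.1) ∘ₗ G :=
  mulOp_comp_commOp_comp_of_support G (fun p hp => hψh p.1 hp) (mulOp_fst_comp_conj_comp_mulOp_fst_eq_zero (a := fun x => 1 - ψ x) W W' hloc)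

omit [Fintype ι] [DecidableEq ι] in
/-- the same without gauge sandwich: `M_{ψ∘pr₁}∘([Δ, M_{h∘pr₁}]∘G) = [Δ, M_{h∘pr₁}]∘G`. [folklore] -/
theorem mulOp_comp_commOp_comp_of_support_fst {F : Type} [AddCommGroup F] [Module ℝ F] {Δ : (X × ι → ℝ) →ₗ[ℝ] (X × ι → ℝ)} (G : F →ₗ[ℝ] (X × ι → ℝ)) {h ψ : X → ℝ}
    (hψh : ∀ x, h x ≠ 0 → ψ x = 1) (hloc : mulOp (fun p : X × ι => 1 - ψ p.1) ∘ₗ Δ ∘ₗ mulOp (fun p : X × ι => h p.1) = 0) :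
    mulOp (fun p : X × ι => ψ p.1) ∘ₗ (commOp Δ (fun p : X × ι => h p.1) ∘ₗ G) = commOp Δ (fun p : X × ι => h p.1) ∘ₗ G :=
  mulOp_comp_commOp_comp_of_support G (fun p hp => hψh p.1 hp) hloc

variable (M : Fin (d + 1) → ℕ) [∀ μ, NeZero (M μ)] (n : ℕ) [NeZero n]

/-- ★ **THE COVARIANT GRAM `c·Q′_TᵀQ′_T` IS BLOCK-DIAGONAL FOR EVERY STAIR DATUM `T`** (n15-c∕181 `csavg_transpose_mul_csavg_apply`): its `((x,i),(z,l))` entry vanishes unless `B(z) = B(x)`.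
[cite: Balaban1985BackgroundPropagators, (3.19) p.393 (the covariant block average: shape)] -/
theorem csavgGram_apply_eq_zero_of_blockOf_ne (T : Fin (d + 1) → Tor (fine n M) → Matrix ι ι ℝ) (c : ℝ) {p q : Tor (fine n M) × ι} (hpq : blockOf n M q.1 ≠ blockOf n M p.1) :
    (c • ((csavg M n T)ᵀ * csavg M n T)) p q = 0 := by
  rw [Matrix.smul_apply, csavg_transpose_mul_csavg_apply, if_neg hpq, smul_zero]

/-- ★ hence `M_{a∘pr₁}∘mulVecLin(c·Q′_TᵀQ′_T)∘M_{b∘pr₁} = 0` as soon as `a(x)·b(z) = 0` whenever `B(z) = B(x)` — for EVERY `T` (every background `U`: `T = cvT e U`; `T ≡ 1` is n15-c∕260 `scQQ`).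
[cite: Balaban1985BackgroundPropagators, (3.24) p.394 (block structure: shape)] -/
theorem mulOp_comp_csavgGram_comp_mulOp_eq_zero (T : Fin (d + 1) → Tor (fine n M) → Matrix ι ι ℝ) (c : ℝ) {a b : Tor (fine n M) → ℝ}
    (hab : ∀ x z, blockOf n M z = blockOf n M x → a x * b z = 0) :
    mulOp (fun p : Tor (fine n M) × ι => a p.1) ∘ₗ Matrix.mulVecLin (c • ((csavg M n T)ᵀ * csavg M n T)) ∘ₗ mulOp (fun p : Tor (fine n M) × ι => b p.1) = 0 := by
  classical
  refine mulOp_comp_comp_mulOp_eq_zero_of_range (fun p q : Tor (fine n M) × ι => blockOf n M q.1 = blockOf n M p.1) (fun f p hf => ?_) fun p q hpq => hab p.1 q.1 hpq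
  rw [Matrix.mulVecLin_apply, Matrix.mulVec, dotProduct]
  refine Finset.sum_eq_zero fun q _ => ?_
  by_cases hq : blockOf n M q.1 = blockOf n M p.1
  · rw [hf q hq, mul_zero]
  · rw [csavgGram_apply_eq_zero_of_blockOf_ne M n T c hq, zero_mul]

end Product

/-! ## §3 The (PC) site carrier: the CURVED operator `Δ_U = covLapM + c·Q′_TᵀQ′_T` (every `U`) and the flat edition -/

section Sites

variable {L : ℕ} [NeZero L] {mv kk : ℕ} {hL : Odd L ∧ 1 < L} (ι : Type) [Fintype ι] [DecidableEq ι]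
variable (hM : ∀ ν, cvM d L mv kk hL ν = 2 * L * L ^ mv) (hm₂ : 2 * L ^ mv + 1 ≤ coverMargin L mv)
  (hfit₂ : coverMargin L mv - 2 * L ^ mv + (6 * L ^ mv + 1) + 1 ≤ L * L ^ mv) (hS0 : L * L ^ mv ≤ 2 * L * L ^ mv)
include hM hm₂ hfit₂ hS0

omit [Fintype ι] [DecidableEq ι] in
/-- THE STENCIL FACTS: `(1 − ψ_k(x))·h_k(x) = (1 − ψ_k(x))·h_k(x + e_μ) = (1 − ψ_k(x))·h_k(x − e_μ) = 0` — the plateau is `1` at and next to every site of the box `{χ_k ≠ 0} ⊇ supp h_k`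
(n15-c∕26x `scPsi_near_scChi`). [cite: Balaban1984PropagatorsII, (2.37) p.229 (shape)] -/
theorem one_sub_scPsi_mul_scH_stencil (k : Fin (d + 1) → ZMod (2 * L)) (hhχ : ∀ x, scH d L mv kk hL k x ≠ 0 → scChi d L mv kk hL k x ≠ 0) :
    (∀ x, (1 - scPsi d L mv kk hL k x) * scH d L mv kk hL k x = 0) ∧ (∀ μ x, (1 - scPsi d L mv kk hL k x) * scH d L mv kk hL k (scShift d L mv kk hL μ x) = 0) ∧
      ∀ μ x, (1 - scPsi d L mv kk hL k x) * scH d L mv kk hL k ((scShift d L mv kk hL μ).symm x) = 0 := by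
  refine ⟨fun x => ?_, fun μ x => ?_, fun μ x => ?_⟩
  · by_cases h0 : scH d L mv kk hL k x = 0
    · rw [h0, mul_zero]
    · rw [(scPsi_near_scChi hM hm₂ hfit₂ hS0 0 k (hhχ x h0)).1, sub_self, zero_mul]
  · by_cases h0 : scH d L mv kk hL k (scShift d L mv kk hL μ x) = 0
    · rw [h0, mul_zero]
    · have h := (scPsi_near_scChi hM hm₂ hfit₂ hS0 μ k (hhχ _ h0)).2.2
      rw [Equiv.symm_apply_apply] at h
      rw [h, sub_self, zero_mul]
  · by_cases h0 : scH d L mv kk hL k ((scShift d L mv kk hL μ).symm x) = 0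
    · rw [h0, mul_zero]
    · have h := (scPsi_near_scChi hM hm₂ hfit₂ hS0 μ k (hhχ _ h0)).2.1
      rw [Equiv.apply_symm_apply] at h
      rw [h, sub_self, zero_mul]

/-- `M_{1−ψ_k}∘Δ_R∘M_{h_k} = 0` for Bałaban's covariant Laplacian with ANY bond transports `R` (dag-n15-w3 `mulOp_comp_covLapM_comp_mulOp_eq_zero` on the stencil facts).
[cite: Balaban1985BackgroundPropagators, (3.50) p.400 (shape); Balaban1984PropagatorsII, (2.37) p.229 (shape)] -/
theorem mulOp_one_sub_scPsi_comp_covLapM_comp_mulOp_scH (η : ℝ) (R : Fin (d + 1) ⊕ Fin (d + 1) → ScX d L mv kk hL → Matrix ι ι ℝ) (k : Fin (d + 1) → ZMod (2 * L))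
    (hhχ : ∀ x, scH d L mv kk hL k x ≠ 0 → scChi d L mv kk hL k x ≠ 0) :
    mulOp (fun p : ScX d L mv kk hL × ι => 1 - scPsi d L mv kk hL k p.1) ∘ₗ covLapM (scShift d L mv kk hL) η R ∘ₗ mulOp (fun p : ScX d L mv kk hL × ι => scH d L mv kk hL k p.1) = 0 :=
  have hs := one_sub_scPsi_mul_scH_stencil hM hm₂ hfit₂ hS0 k hhχ
  mulOp_comp_covLapM_comp_mulOp_eq_zero (scShift d L mv kk hL) η R (hX := fun x => 1 - scPsi d L mv kk hL k x) (kX := scH d L mv kk hL k) hs.1 hs.2.1 hs.2.2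

omit [DecidableEq ι] in
/-- `M_{1−ψ_k}∘V̂∘M_{h_k} = 0` for EVERY background species `V̂ = M_C + Σ_μ(M_{A⁺_μ}∇⁺_μ + M_{A⁻_μ}∇⁻_μ)` (n15-b `speciesOpM`, any coefficients `C, A` — the jet `V̂_k` of the cube; dag-n15-w3
`mulOp_comp_speciesOpM_comp_mulOp_eq_zero` on the stencil facts). [cite: Balaban1985BackgroundPropagators, (3.51)–(3.53) p.400 (shape)] -/
theorem mulOp_one_sub_scPsi_comp_speciesOpM_comp_mulOp_scH (n : ℝ) (C : ScX d L mv kk hL → Matrix ι ι ℝ) (A : Fin (d + 1) ⊕ Fin (d + 1) → ScX d L mv kk hL → Matrix ι ι ℝ)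
    (k : Fin (d + 1) → ZMod (2 * L)) (hhχ : ∀ x, scH d L mv kk hL k x ≠ 0 → scChi d L mv kk hL k x ≠ 0) :
    mulOp (fun p : ScX d L mv kk hL × ι => 1 - scPsi d L mv kk hL k p.1) ∘ₗ speciesOpM (scShift d L mv kk hL) n C A ∘ₗ mulOp (fun p : ScX d L mv kk hL × ι => scH d L mv kk hL k p.1) = 0 :=
  have hs := one_sub_scPsi_mul_scH_stencil hM hm₂ hfit₂ hS0 k hhχ
  mulOp_comp_speciesOpM_comp_mulOp_eq_zero (scShift d L mv kk hL) n C A (hX := fun x => 1 - scPsi d L mv kk hL k x) (kX := scH d L mv kk hL k) hs.1 hs.2.1 hs.2.2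

omit [Fintype ι] [DecidableEq ι] in
/-- `M_{1−ψ_k}∘(Σ_μ∇*_μ∇_μ + W_p)∘M_{h_k} = 0` for the dressed Laplacian with ANY zero-order∕nonlocal part `W_p` carrying its own locality row (dag-n15-w3 `mulOp_comp_lapOp_comp_mulOp`: the
second-order part drops between the separated multipliers). [cite: Balaban1985BackgroundPropagators, (3.26) p.395 (shape); Balaban1984PropagatorsII, (2.38) p.229 (mechanism)] -/
theorem mulOp_one_sub_scPsi_comp_lapOp_comp_mulOp_scH_of_row (cc : ℝ) (Wp : (ScX d L mv kk hL × ι → ℝ) →ₗ[ℝ] (ScX d L mv kk hL × ι → ℝ)) (k : Fin (d + 1) → ZMod (2 * L))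
    (hhχ : ∀ x, scH d L mv kk hL k x ≠ 0 → scChi d L mv kk hL k x ≠ 0)
    (hWp : mulOp (fun p : ScX d L mv kk hL × ι => 1 - scPsi d L mv kk hL k p.1) ∘ₗ Wp ∘ₗ mulOp (fun p : ScX d L mv kk hL × ι => scH d L mv kk hL k p.1) = 0) :
    mulOp (fun p : ScX d L mv kk hL × ι => 1 - scPsi d L mv kk hL k p.1) ∘ₗ lapOp cc (fun μ => liftEquiv (scShift d L mv kk hL μ) ι) Wp ∘ₗ
      mulOp (fun p : ScX d L mv kk hL × ι => scH d L mv kk hL k p.1) = 0 := by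
  have hs := one_sub_scPsi_mul_scH_stencil hM hm₂ hfit₂ hS0 k hhχ
  rw [mulOp_comp_lapOp_comp_mulOp (scShift d L mv kk hL) cc (hX := fun x => 1 - scPsi d L mv kk hL k x) (kX := scH d L mv kk hL k) Wp hs.1 hs.2.1 hs.2.2, hWp]

/-- `M_{1−ψ_k}∘mulVecLin(c·Q′_TᵀQ′_T)∘M_{h_k} = 0` for EVERY stair datum `T` on the (PC) site carrier: a block meeting `supp h_k` lies in the box (`χ_k` is block-constant) hence under the
plateau. [cite: Balaban1985BackgroundPropagators, (3.19) p.393, (3.24) p.394 (block structure: shape)] -/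
theorem mulOp_one_sub_scPsi_comp_csavgGram_comp_mulOp_scH (T : Fin (d + 1) → ScX d L mv kk hL → Matrix ι ι ℝ) (c : ℝ) (k : Fin (d + 1) → ZMod (2 * L))
    (hhχ : ∀ x, scH d L mv kk hL k x ≠ 0 → scChi d L mv kk hL k x ≠ 0) :
    mulOp (fun p : ScX d L mv kk hL × ι => 1 - scPsi d L mv kk hL k p.1) ∘ₗ Matrix.mulVecLin (c • ((csavg (cvM d L mv kk hL) (L ^ kk) T)ᵀ * csavg (cvM d L mv kk hL) (L ^ kk) T)) ∘ₗ
      mulOp (fun p : ScX d L mv kk hL × ι => scH d L mv kk hL k p.1) = 0 := by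
  refine mulOp_comp_csavgGram_comp_mulOp_eq_zero (cvM d L mv kk hL) (L ^ kk) T c (a := fun x => 1 - scPsi d L mv kk hL k x) (b := scH d L mv kk hL k) fun x z hb => ?_
  by_cases hz : scH d L mv kk hL k z = 0
  · rw [hz, mul_zero]
  · have hχ : scChi d L mv kk hL k x ≠ 0 := by
      have e : scChi d L mv kk hL k x = scChi d L mv kk hL k z := by simp only [scChi, chiCube, hb]
      rw [e]; exact hhχ z hz
    rw [(scPsi_near_scChi hM hm₂ hfit₂ hS0 0 k hχ).1, sub_self, zero_mul]

/-- ★★ **THE CURVED (C5) ROW — 333's `hKout` ON SITES FOR BAŁABAN's OPERATOR `Δ_U = covLapM + c·Q′_TᵀQ′_T`, EVERY `U`**: for all bond transports `R`, stair data `T`, matrix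
coefficients `W, W′` (the cube's gauge pair) and right factors `G` (the cube's propagator),
`M_{ψ_k∘pr₁}∘([M_W∘Δ_U∘M_{W′}, M_{h_k∘pr₁}]∘G) = [M_W∘Δ_U∘M_{W′}, M_{h_k∘pr₁}]∘G`.
[cite: Balaban1985BackgroundPropagators, (3.24) p.394, (3.50) p.400, (3.88)–(3.89) p.409 (shapes); Balaban1984PropagatorsII, (2.92)–(2.93) p.239 (shape)] -/
theorem mulOp_scPsi_comp_commOp_conj_comp {F : Type} [AddCommGroup F] [Module ℝ F] (η c : ℝ) (R : Fin (d + 1) ⊕ Fin (d + 1) → ScX d L mv kk hL → Matrix ι ι ℝ)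
    (T : Fin (d + 1) → ScX d L mv kk hL → Matrix ι ι ℝ) (W W' : ScX d L mv kk hL → Matrix ι ι ℝ) (G : F →ₗ[ℝ] (ScX d L mv kk hL × ι → ℝ)) (k : Fin (d + 1) → ZMod (2 * L))
    (hhχ : ∀ x, scH d L mv kk hL k x ≠ 0 → scChi d L mv kk hL k x ≠ 0) :
    mulOp (fun p : ScX d L mv kk hL × ι => scPsi d L mv kk hL k p.1) ∘ₗ
        (commOp (mmulOp W ∘ₗ (covLapM (scShift d L mv kk hL) η R + Matrix.mulVecLin (c • ((csavg (cvM d L mv kk hL) (L ^ kk) T)ᵀ * csavg (cvM d L mv kk hL) (L ^ kk) T))) ∘ₗ mmulOp W')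
          (fun p : ScX d L mv kk hL × ι => scH d L mv kk hL k p.1) ∘ₗ G) =
      commOp (mmulOp W ∘ₗ (covLapM (scShift d L mv kk hL) η R + Matrix.mulVecLin (c • ((csavg (cvM d L mv kk hL) (L ^ kk) T)ᵀ * csavg (cvM d L mv kk hL) (L ^ kk) T))) ∘ₗ mmulOp W')
          (fun p : ScX d L mv kk hL × ι => scH d L mv kk hL k p.1) ∘ₗ G :=
  mulOp_comp_commOp_conj_comp_of_support W W' G (fun x hx => (scPsi_near_scChi hM hm₂ hfit₂ hS0 0 k (hhχ x hx)).1)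
    (mulOp_comp_add_comp_mulOp_eq_zero (mulOp_one_sub_scPsi_comp_covLapM_comp_mulOp_scH ι hM hm₂ hfit₂ hS0 η R k hhχ)
      (mulOp_one_sub_scPsi_comp_csavgGram_comp_mulOp_scH ι hM hm₂ hfit₂ hS0 T c k hhχ))

/-- the FLAT edition (`U ≡ 1`): `Δ = lapOp cc (liftEquiv scShift) 0 + scQQ a ι` (n15-c∕26x `mulOp_one_sub_scPsi_comp_lapOp_comp_mulOp_scH` + `mulOp_one_sub_scPsi_comp_scQQ_comp_mulOp_scH`),
any `W, W′, G`. [cite: Balaban1985BackgroundPropagators, (3.24)–(3.26) pp.394–395 (shapes); Balaban1984PropagatorsII, (2.92)–(2.93) p.239 (shape)] -/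
theorem mulOp_scPsi_comp_commOp_conj_comp_flat {F : Type} [AddCommGroup F] [Module ℝ F] (cc a : ℝ) (W W' : ScX d L mv kk hL → Matrix ι ι ℝ) (G : F →ₗ[ℝ] (ScX d L mv kk hL × ι → ℝ))
    (k : Fin (d + 1) → ZMod (2 * L)) (hhχ : ∀ x, scH d L mv kk hL k x ≠ 0 → scChi d L mv kk hL k x ≠ 0) :
    mulOp (fun p : ScX d L mv kk hL × ι => scPsi d L mv kk hL k p.1) ∘ₗ
        (commOp (mmulOp W ∘ₗ (lapOp cc (fun μ => liftEquiv (scShift d L mv kk hL μ) ι) 0 + scQQ d L mv kk hL a ι) ∘ₗ mmulOp W') (fun p : ScX d L mv kk hL × ι => scH d L mv kk hL k p.1) ∘ₗ G) =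
      commOp (mmulOp W ∘ₗ (lapOp cc (fun μ => liftEquiv (scShift d L mv kk hL μ) ι) 0 + scQQ d L mv kk hL a ι) ∘ₗ mmulOp W') (fun p : ScX d L mv kk hL × ι => scH d L mv kk hL k p.1) ∘ₗ G :=
  mulOp_comp_commOp_conj_comp_of_support W W' G (fun x hx => (scPsi_near_scChi hM hm₂ hfit₂ hS0 0 k (hhχ x hx)).1)
    (mulOp_comp_add_comp_mulOp_eq_zero (mulOp_one_sub_scPsi_comp_lapOp_comp_mulOp_scH ι hM hm₂ hfit₂ hS0 cc k hhχ)
      (mulOp_one_sub_scPsi_comp_scQQ_comp_mulOp_scH ι hM hm₂ hfit₂ hS0 a k hhχ))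

end Sites

end Summit.QuantumFields.YangMills.BalabanUVNodes.N15.Gluing

end
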